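import Summits.KontsevichZagierPeriods.KontsevichZagierPeriods.Theses.LevelPairing
import Summits.KontsevichZagierPeriods.KontsevichZagierPeriods.Theorems.K2SymbolChainsJensenIsScissorsToolkit
import Summits.KontsevichZagierPeriods.KontsevichZagierPeriods.Theorems.HermiteRigidityGenusTwoCycleTransferPushforwardDimOne
import Summits.KontsevichZagierPeriods.KontsevichZagierPeriods.Theorems.UnfoldedStokesLegendreAllModuliStubHalfLineTail
import Summits.KontsevichZagierPeriods.KontsevichZagierPeriods.Theorems.MzvKernelInKZ.Negative.PiLine
import Literature.NumberTheory.Transcendental.KZSemiCanonicalReductionDimOne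
import Literature.NumberTheory.Transcendental.SemialgebraicMapsProofs
import Literature.NumberTheory.Transcendental.KZIntervalPeriodProofs

/-!
# `PiPairByRules12` (stmt-KontsevichZagierPeriods-4701, route LevelPairing) — proof

CALIBRATION — Kontsevich–Zagier's first example (§1.1 eq. (1), `∫_{-1}^{1} 2√(1−x²) dx = π =
∫_{-1}^{1} dx/√(1−x²)`) redone INSIDE THE NEWTON–LEIBNIZ-FREE SUB-CALCULUS: for
`r = [(−1,1), f]`, `f = 2√(1−x²)`, and `r' = [(−1,1), f']`, `f' = (√(1−x²))⁻¹`, the difference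
`[r] − [r']` lies in `closure (domainAddRel ∪ integrandAddRel ∪ changeOfVariablesRel)` (rules 1a,
1b, 2 only; in the tree's reading the pair is otherwise ONE rule-3 move with primitive `x√(1−x²)`).

The chain (the planner's, dimension `1` throughout), written for an arbitrary subgroup `S`
containing the three scissors move sets with the bookkeeping kit of
`Theorems/K2SymbolChainsJensenIsScissorsToolkit.lean`:
* rule 1b: `[r] − [r'] ≡ [d]`, `d = [(−1,1), g]`, `g = f − f' = (1−2x²)/√(1−x²) = (x√(1−x²))′`;
* rule 1a: `[d] ≡ [p] + [q]`, the pieces over `(0,1)` and `(−1,0]`;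
* `reflect_step` (rule 2 + null sets): `g` is even, so the reflection `x ↦ −x` carries `p` onto a
  representation over `(−1,0)` which differs from `q` by the null set `{0}`: `[q] ≡ [p]`;
* `fold_step` (rules 1a, 1b, 2): cut `p` at `1/√2` into `P` over `(0,1/√2)` and `Q` over
  `[1/√2,1)`; the fold `Ψ(x) = √(1−x²)` maps `(0,1/√2)` injectively onto `(1/√2,1)` with
  `|Ψ′(x)| = x/√(1−x²)` and `g` is ANTI-invariant, `−g(x) = g(Ψ x)·|Ψ′(x)|`, so `−P` is carried by
  one change of variables onto a representation `Q₁` over `(1/√2,1)` with integrand `g`, equal to `Q`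
  up to the null set `{1/√2}`; with `[P] + [−P] ≡ 0` this gives `[p] ≡ [P] + [Q] ≡ −[Q₁] + [Q] ≡ 0`.
Hence `[r] − [r'] ≡ [d] ≡ 2·[p] ≡ 0`.
-/

noncomputable section

open MeasureTheory Set
open Literature.NumberTheory.Transcendental
open Literature.ModelTheory.ExponentialFields (IsSemialgebraic isSemialgebraic_univ
  isSemialgebraic_setOf_eval_pos)
open MvPolynomial (aeval X C)
open Summit.KontsevichZagierPeriods.K2SymbolChains.JensenIsScissorsProof
open Summit.KontsevichZagierPeriods.HermiteRigidity.GenusTwoCycleTransfer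
  (det_smul_id_fin_one hasFDerivAt_fin_one)
open Summit.KontsevichZagierPeriods.UnfoldedStokes.LegendreAllModuliLine.M5 (isSemialgebraic_posSet)
open Summit.KontsevichZagierPeriods.MzvKernelInKZ.Negative (volume_pt1)
open Literature.NumberTheory.Transcendental.KZ (eq_const_apply_zero)

namespace Summit.KontsevichZagierPeriods.LevelPairing

variable {S : AddSubgroup KZ.FormalRep}

/-- **Reflection step** (rules 1a and 2 only). Let `d = [(−1,1), g]` with `g` even on `(−1,1)`, and
let `p`, `q` be the pieces of `d` over `(0,1)` and `(−1,0]`. Then `[q] − [p] ∈ S` for every subgroup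
`S` containing the scissors move sets: the reflection `x ↦ −x` is a change of variables carrying `p`
to a representation over `(−1,0)` (`exists_image_rep`), which differs from `q` by the null set `{0}`
(`of_sub_of_mem_of_symmDiff`). [cite: KontsevichZagier2001, §1.2 rules (1)-(2)] -/
theorem reflect_step (hS : KZ.domainAddRel ∪ KZ.integrandAddRel ∪ KZ.changeOfVariablesRel ⊆ S)
    {d p q : KZ.IntegralRep 1} (hd : d.domain = {z | z 0 ∈ Ioo (-1 : ℝ) 1})
    (hp : p.domain = d.domain ∩ {z | 0 < z 0}) (hpi : p.integrand = d.integrand)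
    (hq : q.domain = d.domain \ {z | 0 < z 0}) (hqi : q.integrand = d.integrand)
    (heven : ∀ x ∈ d.domain, d.integrand (fun _ => -x 0) = d.integrand x) :
    KZ.of q - KZ.of p ∈ S := by
  have hps : IsSemialgebraic ℚ p.domain := p.isSemialgebraic_domain
  -- the reflection as rule-(2) data on `p.domain = (0,1)`
  have hΦ : IsSemialgebraicMapOn ℚ p.domain (fun z : Fin 1 → ℝ => fun _ : Fin 1 => -z 0) :=
    IsSemialgebraicMapOn.of_forall hps fun _ => (isSemialgebraicFunOn_apply hps 0).neg
  have hΦ' : ∀ x ∈ p.domain, HasFDerivWithinAt (fun z : Fin 1 → ℝ => fun _ : Fin 1 => -z 0)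
      (((-1 : ℝ)) • ContinuousLinearMap.id ℝ (Fin 1 → ℝ)) p.domain x := fun x _ =>
    (hasFDerivAt_fin_one (fun t => -t) (-1) x (hasDerivAt_neg (x 0))).hasFDerivWithinAt
  have hinj : InjOn (fun z : Fin 1 → ℝ => fun _ : Fin 1 => -z 0) p.domain := by
    intro a _ b _ hab
    have h := congrFun hab 0
    simp only [neg_inj] at h
    rw [eq_const_apply_zero a, eq_const_apply_zero b, h]
  have himg : (fun z : Fin 1 → ℝ => fun _ : Fin 1 => -z 0) '' p.domain ⊆ d.domain := by
    rintro _ ⟨x, hx, rfl⟩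
    rw [hp, hd] at hx
    rw [hd]
    simp only [mem_inter_iff, mem_setOf_eq, mem_Ioo] at hx ⊢
    exact ⟨by linarith [hx.1.2], by linarith [hx.2]⟩
  have hf' : IsSemialgebraicFunOn ℚ ((fun z : Fin 1 → ℝ => fun _ : Fin 1 => -z 0) '' p.domain)
      d.integrand :=
    d.isSemialgebraicFunOn_integrand.mono himg
      (IsSemialgebraicMapOn.isSemialgebraic_image_holds hΦ subset_rfl hps)
  have hff' : ∀ x ∈ p.domain, p.integrand x =
      d.integrand ((fun z : Fin 1 → ℝ => fun _ : Fin 1 => -z 0) x) *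
        |(((-1 : ℝ)) • ContinuousLinearMap.id ℝ (Fin 1 → ℝ)).det| := by
    intro x hx
    have hxd : x ∈ d.domain := by rw [hp] at hx; exact hx.1
    rw [det_smul_id_fin_one, hpi, heven x hxd]
    simp
  obtain ⟨R, hRd, hRi, hR⟩ := exists_image_rep p hΦ hΦ' hinj hf' hff'
  -- `q` and `R` differ by the null set `{0}`
  have hqR : KZ.of q - KZ.of R ∈ S := by
    refine of_sub_of_mem_of_symmDiff hS ?_ ?_ fun x _ => by rw [hqi, hRi]
    · refine measure_mono_null (fun z hz => ?_) (volume_pt1 0)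
      rw [hRd] at hz
      obtain ⟨hzq, hzR⟩ := hz
      rw [hq, hd] at hzq
      simp only [mem_sdiff, mem_setOf_eq, mem_Ioo, not_lt] at hzq
      rcases hzq.2.lt_or_eq with hlt | heq
      · refine (hzR ⟨fun _ => -z 0, ?_, ?_⟩).elim
        · rw [hp, hd]
          simp only [mem_inter_iff, mem_setOf_eq, mem_Ioo]
          exact ⟨⟨by linarith [hzq.1.2], by linarith [hzq.1.1]⟩, by linarith⟩
        · rw [eq_const_apply_zero z]
          simp
      · exact heq
    · rw [hRd, sdiff_eq_empty.mpr ?_, measure_empty]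
      · rintro _ ⟨x, hx, rfl⟩
        rw [hp, hd] at hx
        rw [hq, hd]
        simp only [mem_inter_iff, mem_setOf_eq, mem_Ioo, mem_sdiff, not_lt] at hx ⊢
        exact ⟨⟨by linarith [hx.1.2], by linarith [hx.2]⟩, by linarith [hx.2]⟩
  have : KZ.of q - KZ.of p = (KZ.of q - KZ.of R) - (KZ.of p - KZ.of R) := by abel
  rw [this]
  exact S.sub_mem hqR (mem_of_mem_changeOfVariablesRel hS hR)

/-- The set `{z | 2·z₀² < 1}` of `ℝ¹` is `ℚ`-semialgebraic. [cite: BCR1998, §2.1] -/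
theorem isSemialgebraic_setOf_two_mul_sq_lt : IsSemialgebraic ℚ {z : Fin 1 → ℝ | 2 * z 0 ^ 2 < 1} := by
  convert isSemialgebraic_setOf_eval_pos (k := ℚ) (R := ℝ) (1 - 2 * X 0 ^ 2 : MvPolynomial (Fin 1) ℚ)
    using 1
  ext z
  simp [sub_pos]

/-- **Folding step** (rules 1a, 1b and 2 only). Let `d = [(−1,1), g]` and let `p` be its piece over
`(0,1)`; assume the anti-invariance `−g(x) = g(√(1−x²)) · x/√(1−x²)` for `0 < x < 1/√2`. Then
`[p] ∈ S` for every subgroup `S` containing the scissors move sets: cut `p` at `1/√2` into `P` over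
`(0,1/√2)` and `Q` over `[1/√2,1)` (rule 1a); the fold `x ↦ √(1−x²)` is a change of variables
carrying `−P` onto a representation `Q₁` over `(1/√2,1)` with integrand `g` (rule 2,
`exists_image_rep`); `Q` and `Q₁` differ by the null set `{1/√2}`; and `[P] + [−P] ∈ S` (rule 1b).
[cite: KontsevichZagier2001, §1.2 rules (1)-(2)] -/
theorem fold_step (hS : KZ.domainAddRel ∪ KZ.integrandAddRel ∪ KZ.changeOfVariablesRel ⊆ S)
    {d p : KZ.IntegralRep 1} (hd : d.domain = {z | z 0 ∈ Ioo (-1 : ℝ) 1})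
    (hp : p.domain = d.domain ∩ {z | 0 < z 0}) (hpi : p.integrand = d.integrand)
    (hanti : ∀ x ∈ p.domain, 2 * x 0 ^ 2 < 1 →
      -d.integrand x = d.integrand (fun _ => √(1 - x 0 ^ 2)) * (x 0 / √(1 - x 0 ^ 2))) :
    KZ.of p ∈ S := by
  have hB := isSemialgebraic_setOf_two_mul_sq_lt
  set P := p.restrict (p.domain ∩ {z : Fin 1 → ℝ | 2 * z 0 ^ 2 < 1}) (p.isSemialgebraic_domain.inter hB)
    inter_subset_left with hP
  set Q := p.restrict (p.domain \ {z : Fin 1 → ℝ | 2 * z 0 ^ 2 < 1}) (p.isSemialgebraic_domain.diff hB)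
    sdiff_subset with hQ
  -- rule 1a: `[p] − [P] − [Q] ∈ S`
  have hsplit : KZ.of p - KZ.of P - KZ.of Q ∈ S := of_sub_restrict_inter_sub_restrict_diff_mem hS p hB
  have hPmem : ∀ x : Fin 1 → ℝ,
      x ∈ P.domain ↔ ((-1 < x 0 ∧ x 0 < 1) ∧ 0 < x 0) ∧ 2 * x 0 ^ 2 < 1 := fun x => by
    show x ∈ p.domain ∩ {z : Fin 1 → ℝ | 2 * z 0 ^ 2 < 1} ↔ _
    rw [hp, hd]
    simp only [mem_inter_iff, mem_setOf_eq, mem_Ioo]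
  have hQmem : ∀ x : Fin 1 → ℝ,
      x ∈ Q.domain ↔ ((-1 < x 0 ∧ x 0 < 1) ∧ 0 < x 0) ∧ ¬2 * x 0 ^ 2 < 1 := fun x => by
    show x ∈ p.domain \ {z : Fin 1 → ℝ | 2 * z 0 ^ 2 < 1} ↔ _
    rw [hp, hd]
    simp only [mem_sdiff, mem_inter_iff, mem_setOf_eq, mem_Ioo]
  -- the fold `Ψ(x) = √(1 − x²)` as rule-(2) data on `P.neg.domain = (0, 1/√2)`
  have hPs : IsSemialgebraic ℚ P.neg.domain := P.neg.isSemialgebraic_domain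
  have hΨ : IsSemialgebraicMapOn ℚ P.neg.domain
      (fun z : Fin 1 → ℝ => fun _ : Fin 1 => √(1 - z 0 ^ 2)) :=
    IsSemialgebraicMapOn.of_forall hPs fun _ =>
      (IsSemialgebraicFunOn.sqrt_holds
        (isSemialgebraicFunOn_aeval hPs (1 - X 0 ^ 2 : MvPolynomial (Fin 1) ℚ))).congr
        fun z _ => by simp
  have hΨ' : ∀ x ∈ P.neg.domain,
      HasFDerivWithinAt (fun z : Fin 1 → ℝ => fun _ : Fin 1 => √(1 - z 0 ^ 2))
        ((-x 0 / √(1 - x 0 ^ 2)) • ContinuousLinearMap.id ℝ (Fin 1 → ℝ)) P.neg.domain x := by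
    intro x hx
    have hx' := (hPmem x).1 hx
    have hpos : 0 < 1 - x 0 ^ 2 := by nlinarith
    have hu : HasDerivAt (fun s : ℝ => 1 - s ^ 2) (-(2 * x 0)) (x 0) := by
      simpa using (hasDerivAt_pow 2 (x 0)).const_sub 1
    have hs : HasDerivAt (fun t : ℝ => √(1 - t ^ 2)) (-x 0 / √(1 - x 0 ^ 2)) (x 0) :=
      (hu.sqrt hpos.ne').congr_deriv (by rw [neg_div, neg_div, mul_div_mul_left _ _ (two_ne_zero' ℝ)])
    exact (hasFDerivAt_fin_one (fun t => √(1 - t ^ 2)) _ x hs).hasFDerivWithinAt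
  have hinj : InjOn (fun z : Fin 1 → ℝ => fun _ : Fin 1 => √(1 - z 0 ^ 2)) P.neg.domain := by
    intro a ha b hb hab
    have ha' := (hPmem a).1 ha
    have hb' := (hPmem b).1 hb
    have h : √(1 - a 0 ^ 2) = √(1 - b 0 ^ 2) := congrFun hab 0
    have h2 : 1 - a 0 ^ 2 = 1 - b 0 ^ 2 := (Real.sqrt_inj (by nlinarith) (by nlinarith)).1 h
    have h3 : a 0 = b 0 := (pow_left_inj₀ ha'.1.2.le hb'.1.2.le two_ne_zero).1 (by linarith)
    rw [eq_const_apply_zero a, eq_const_apply_zero b, h3]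
  have himg : (fun z : Fin 1 → ℝ => fun _ : Fin 1 => √(1 - z 0 ^ 2)) '' P.neg.domain ⊆ d.domain := by
    rintro _ ⟨x, hx, rfl⟩
    have hx' := (hPmem x).1 hx
    rw [hd]
    simp only [mem_setOf_eq, mem_Ioo]
    exact ⟨by linarith [Real.sqrt_nonneg (1 - x 0 ^ 2)], (Real.sqrt_lt' one_pos).2 (by nlinarith)⟩
  have hf' : IsSemialgebraicFunOn ℚ
      ((fun z : Fin 1 → ℝ => fun _ : Fin 1 => √(1 - z 0 ^ 2)) '' P.neg.domain) d.integrand :=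
    d.isSemialgebraicFunOn_integrand.mono himg
      (IsSemialgebraicMapOn.isSemialgebraic_image_holds hΨ subset_rfl hPs)
  have hff' : ∀ x ∈ P.neg.domain, P.neg.integrand x =
      d.integrand ((fun z : Fin 1 → ℝ => fun _ : Fin 1 => √(1 - z 0 ^ 2)) x) *
        |((-x 0 / √(1 - x 0 ^ 2)) • ContinuousLinearMap.id ℝ (Fin 1 → ℝ)).det| := by
    intro x hx
    have hx' := (hPmem x).1 hx
    have hxp : x ∈ p.domain := hx.1
    have hpos : 0 < 1 - x 0 ^ 2 := by nlinarith
    rw [det_smul_id_fin_one, abs_div, abs_neg, abs_of_pos hx'.1.2, abs_of_pos (Real.sqrt_pos.2 hpos)]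
    show -p.integrand x = _
    rw [hpi]
    exact hanti x hxp hx'.2
  obtain ⟨Q₁, hQ₁d, hQ₁i, hQ₁⟩ := exists_image_rep P.neg hΨ hΨ' hinj hf' hff'
  -- `Q` and `Q₁` differ by the null set `{1/√2}`
  have hQQ : KZ.of Q - KZ.of Q₁ ∈ S := by
    refine of_sub_of_mem_of_symmDiff hS ?_ ?_ fun x _ => ?_
    · rw [hQ₁d]
      refine measure_mono_null (fun z hz => ?_) (volume_pt1 (√(1 / 2)))
      obtain ⟨hzQ, hzR⟩ := hz
      have hz' := (hQmem z).1 hzQ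
      have h1 : 0 < 1 - z 0 ^ 2 := by nlinarith
      rcases (not_lt.1 hz'.2).lt_or_eq with hgt | heq
      · refine (hzR ⟨fun _ => √(1 - z 0 ^ 2), (hPmem _).2 ?_, ?_⟩).elim
        · refine ⟨⟨⟨by linarith [Real.sqrt_nonneg (1 - z 0 ^ 2)],
            (Real.sqrt_lt' one_pos).2 (by nlinarith)⟩, Real.sqrt_pos.2 h1⟩, ?_⟩
          rw [Real.sq_sqrt h1.le]
          linarith
        · rw [eq_const_apply_zero z]
          show (fun _ : Fin 1 => √(1 - √(1 - z 0 ^ 2) ^ 2)) = fun _ => z 0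
          rw [Real.sq_sqrt h1.le, sub_sub_cancel, Real.sqrt_sq hz'.1.2.le]
      · show z 0 = √(1 / 2)
        rw [← Real.sqrt_sq hz'.1.2.le]
        congr 1
        linarith
    · rw [hQ₁d, sdiff_eq_empty.mpr ?_, measure_empty]
      rintro _ ⟨x, hx, rfl⟩
      have hx' := (hPmem x).1 hx
      have h1 : 0 < 1 - x 0 ^ 2 := by nlinarith
      refine (hQmem _).2 ⟨⟨⟨by linarith [Real.sqrt_nonneg (1 - x 0 ^ 2)],
        (Real.sqrt_lt' one_pos).2 (by nlinarith)⟩, Real.sqrt_pos.2 h1⟩, ?_⟩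
      show ¬2 * √(1 - x 0 ^ 2) ^ 2 < 1
      rw [Real.sq_sqrt h1.le]
      linarith
    · show p.integrand x = Q₁.integrand x
      rw [hQ₁i, hpi]
  -- rule 1b: `[P] + [−P] ∈ S`; assemble
  have hPP : KZ.of P + KZ.of P.neg ∈ S := of_add_of_neg_mem hS P
  have : KZ.of p = (KZ.of p - KZ.of P - KZ.of Q) + (KZ.of P + KZ.of P.neg) -
      (KZ.of P.neg - KZ.of Q₁) + (KZ.of Q - KZ.of Q₁) := by abel
  rw [this]
  exact S.add_mem (S.sub_mem (S.add_mem hsplit hPP) (mem_of_mem_changeOfVariablesRel hS hQ₁)) hQQ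

/-- **`PiPairByRules12`** (route LevelPairing, stmt-KontsevichZagierPeriods-4701): KZ's first example
redone WITHOUT the Newton–Leibniz move — for `r = [(−1,1), f]` with `f = 2√(1−x²)` and
`r' = [(−1,1), f']` with `f' = (√(1−x²))⁻¹` on `(−1,1)`, `[r] − [r'] ∈ closure (1a ∪ 1b ∪ 2)`.
Chain: `[r] − [r'] ≡ [d]` with `d = [(−1,1), f − f']` (1b); `[d] ≡ [d|(0,1)] + [d|(−1,0]]` (1a);
`[d|(−1,0]] ≡ [d|(0,1)]` by the reflection `x ↦ −x` (2, `g = f − f'` is even) up to the null set `{0}`;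
and `[d|(0,1)] ≡ 0` by the folding step: `g = (1 − 2x²)·… = (x√(1−x²))′` is anti-invariant under the
fold `x ↦ √(1−x²)` of `(0,1/√2)` onto `(1/√2,1)`, `−g(x) = g(√(1−x²))·x/√(1−x²)`. Ten moves, dimension
`1` throughout. [cite: KontsevichZagier2001, §1.1 eq. (1), §1.2 rules (1)-(2)] -/
theorem piPairByRules12_proof :
    Summit.KontsevichZagierPeriods.KontsevichZagierPeriods.Theses.LevelPairing.PiPairByRules12 := by
  intro r r' hrd hri hr'd hr'i
  set S := AddSubgroup.closure (KZ.domainAddRel ∪ KZ.integrandAddRel ∪ KZ.changeOfVariablesRel)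
    with hSdef
  have hS : KZ.domainAddRel ∪ KZ.integrandAddRel ∪ KZ.changeOfVariablesRel ⊆ (S : Set KZ.FormalRep) :=
    AddSubgroup.subset_closure
  have hdom : r'.domain = r.domain := by rw [hrd, hr'd]
  -- the difference representation `d = [(−1,1), f − f']`
  obtain ⟨d, hdd, hdi⟩ : ∃ d : KZ.IntegralRep 1, d.domain = r.domain ∧
      d.integrand = fun x => r.integrand x - r'.integrand x := by
    have hsa : IsSemialgebraicFunOn ℚ r.domain r'.integrand := hdom ▸ r'.isSemialgebraicFunOn_integrand
    have hint : IntegrableOn r'.integrand r.domain := hdom ▸ r'.integrableOn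
    exact ⟨⟨r.domain, fun x => r.integrand x - r'.integrand x, r.isSemialgebraic_domain,
      IsSemialgebraicFunOn.sub_holds r.isSemialgebraicFunOn_integrand hsa,
      r.integrableOn.sub hint⟩, rfl, rfl⟩
  have hdI : d.domain = {z | z 0 ∈ Ioo (-1 : ℝ) 1} := hdd.trans hrd
  have hdf : ∀ x ∈ d.domain, d.integrand x = 2 * √(1 - x 0 ^ 2) - (√(1 - x 0 ^ 2))⁻¹ := by
    intro x hx
    rw [hdd] at hx
    have hx' : x ∈ r'.domain := by rw [hdom]; exact hx
    rw [hdi]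
    show r.integrand x - r'.integrand x = _
    rw [hri hx, hr'i hx']
  -- rule 1b: `[r] − [r'] − [d] ∈ S`
  have h1 : KZ.of r - KZ.of r' - KZ.of d ∈ S :=
    of_sub_of_sub_mem_of_add hS hdom hdd fun x _ => by simp [hdi]
  -- rule 1a: split `d` at `0`
  have hA := isSemialgebraic_posSet
  set p := d.restrict (d.domain ∩ {z : Fin 1 → ℝ | 0 < z 0}) (d.isSemialgebraic_domain.inter hA)
    inter_subset_left with hp
  set q := d.restrict (d.domain \ {z : Fin 1 → ℝ | 0 < z 0}) (d.isSemialgebraic_domain.diff hA)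
    sdiff_subset with hq
  have h2 : KZ.of d - KZ.of p - KZ.of q ∈ S := of_sub_restrict_inter_sub_restrict_diff_mem hS d hA
  -- rule 2 (reflection): `[q] − [p] ∈ S`, the integrand `f − f'` being even
  have heven : ∀ x ∈ d.domain, d.integrand (fun _ => -x 0) = d.integrand x := by
    intro x hx
    have hx' : (fun _ => -x 0 : Fin 1 → ℝ) ∈ d.domain := by
      rw [hdI] at hx ⊢
      simp only [mem_setOf_eq, mem_Ioo] at hx ⊢
      constructor <;> linarith
    rw [hdf _ hx', hdf x hx]
    simp only [neg_sq]
  have h3 : KZ.of q - KZ.of p ∈ S := reflect_step hS hdI rfl rfl rfl rfl heven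
  -- rules 1a, 1b, 2 (fold): `[p] ∈ S`, the integrand being anti-invariant under `x ↦ √(1−x²)`
  have hanti : ∀ x ∈ p.domain, 2 * x 0 ^ 2 < 1 →
      -d.integrand x = d.integrand (fun _ => √(1 - x 0 ^ 2)) * (x 0 / √(1 - x 0 ^ 2)) := by
    intro x hx _
    have hxd : x ∈ d.domain := hx.1
    have hx0 : 0 < x 0 := hx.2
    have hxI : -1 < x 0 ∧ x 0 < 1 := by
      rw [hdI] at hxd
      simpa only [mem_setOf_eq, mem_Ioo] using hxd
    have hu : 0 < 1 - x 0 ^ 2 := by nlinarith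
    have hy : (fun _ => √(1 - x 0 ^ 2) : Fin 1 → ℝ) ∈ d.domain := by
      rw [hdI]
      simp only [mem_setOf_eq, mem_Ioo]
      exact ⟨by linarith [Real.sqrt_nonneg (1 - x 0 ^ 2)], (Real.sqrt_lt' one_pos).2 (by nlinarith)⟩
    rw [hdf x hxd, hdf _ hy]
    show -(2 * √(1 - x 0 ^ 2) - (√(1 - x 0 ^ 2))⁻¹) =
      (2 * √(1 - √(1 - x 0 ^ 2) ^ 2) - (√(1 - √(1 - x 0 ^ 2) ^ 2))⁻¹) * (x 0 / √(1 - x 0 ^ 2))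
    rw [Real.sq_sqrt hu.le, sub_sub_cancel, Real.sqrt_sq hx0.le]
    obtain ⟨s, hs0, hs2, hs⟩ : ∃ s : ℝ, 0 < s ∧ s ^ 2 = 1 - x 0 ^ 2 ∧ √(1 - x 0 ^ 2) = s :=
      ⟨_, Real.sqrt_pos.2 hu, Real.sq_sqrt hu.le, rfl⟩
    rw [hs]
    have hx0' : x 0 ≠ 0 := hx0.ne'
    have hs0' : s ≠ 0 := hs0.ne'
    field_simp
    linear_combination (-2) * hs2
  have h4 : KZ.of p ∈ S := fold_step hS hdI rfl rfl hanti
  have : KZ.of r - KZ.of r' = (KZ.of r - KZ.of r' - KZ.of d) + (KZ.of d - KZ.of p - KZ.of q) +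
      (KZ.of q - KZ.of p) + 2 • KZ.of p := by abel
  rw [this]
  exact S.add_mem (S.add_mem (S.add_mem h1 h2) h3) (S.nsmul_mem h4 2)

end Summit.KontsevichZagierPeriods.LevelPairing

end
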